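import Mathlib
import HarnessLib
import Summits.KontsevichZagierPeriods.KontsevichZagierPeriods.Theorems.LinRedNormalFormArrangementNormalFormStubIntegrateOutPieces

/-!
# `stub_integrateOut` (line `janus-bands`), part 3: integrating out a pole of order `≥ 2`

`IntegrateOut.flat_pole`: a bounded representation on
`{(x, y) | x ∈ poly ZRs, P(x) < y (P ∈ LWs), y < S(x) (S ∈ UPs)}` with integrand
`ratJ(x) · (y − ℓ(x))^{-(n'+2)}` is congruent modulo the KZ moves to a `ℤ`-combination of
elements of `JJ B 0`: dissect by (largest lower bound `P`, smallest upper bound `S`, side of the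
pole) — rule 1a: ties are null hyperplanes, the middle region `P ≤ ℓ ≤ S` is null by Tonelli
(the fibre integral `∫_P^S |y − ℓ|^{-(n'+2)} dy` diverges) off the null zero set of `ratJ`
(degenerate data give a zero integrand) — and apply `piece_step` on each piece.

Registered sub-goal proved here: `integrateOut_flatPole`.
[Kontsevich–Zagier 2001, §1.2, rules (1)–(3)]
-/

noncomputable section

open Set MeasureTheory
open Literature.NumberTheory.Transcendental
open Literature.ModelTheory.ExponentialFields

namespace Summit.KontsevichZagierPeriods.ArrangementNormalForm.JanusBands

namespace IntegrateOut

/-! ### The base polytope of a piece -/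

/-- The rows of the base polytope of a piece: the `y`-free rows, "`P` is the largest lower
bound", "`S` is the smallest upper bound", and `P < S`. [folklore] -/
def rowsP₀ {B : ℕ} (ZRs LWs UPs : Finset ((Fin B → ℚ) × ℚ)) (P S : (Fin B → ℚ) × ℚ) :
    Finset ((Fin B → ℚ) × ℚ) :=
  ZRs ∪ (LWs.erase P).image (fun P' => P - P') ∪ (UPs.erase S).image (fun S' => S' - S) ∪
    {S - P}

/-- Membership in the base polytope of a piece, unfolded. [folklore] -/
theorem mem_poly_rowsP₀ {B : ℕ} (ZRs LWs UPs : Finset ((Fin B → ℚ) × ℚ))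
    (P S : (Fin B → ℚ) × ℚ) (x : Fin B → ℝ) :
    x ∈ poly B (rowsP₀ ZRs LWs UPs P S) ↔
      x ∈ poly B ZRs ∧ (∀ P', P' ≠ P → P' ∈ LWs → ev P' x < ev P x) ∧
      (∀ S', S' ≠ S → S' ∈ UPs → ev S x < ev S' x) ∧ ev P x < ev S x := by
  simp only [poly, mem_setOf_eq, rowsP₀, Finset.forall_mem_union, Finset.mem_singleton,
    forall_eq, Finset.forall_mem_image, Finset.mem_erase, and_imp, ev_sub, sub_pos]
  tauto

/-- The rows of a piece in the pole case: additionally the side of the pole `ℓ`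
(`σ = true`: `ℓ < P`; `σ = false`: `S < ℓ`). [folklore] -/
def rowsP {B : ℕ} (ZRs LWs UPs : Finset ((Fin B → ℚ) × ℚ)) (P S ℓ : (Fin B → ℚ) × ℚ)
    (σ : Bool) : Finset ((Fin B → ℚ) × ℚ) :=
  insert (if σ then P - ℓ else ℓ - S) (rowsP₀ ZRs LWs UPs P S)

/-- Membership in the base polytope of a piece (pole case), unfolded. [folklore] -/
theorem mem_poly_rowsP {B : ℕ} (ZRs LWs UPs : Finset ((Fin B → ℚ) × ℚ))
    (P S ℓ : (Fin B → ℚ) × ℚ) (σ : Bool) (x : Fin B → ℝ) :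
    x ∈ poly B (rowsP ZRs LWs UPs P S ℓ σ) ↔
      x ∈ poly B (rowsP₀ ZRs LWs UPs P S) ∧
      (if σ then ev ℓ x < ev P x else ev S x < ev ℓ x) := by
  cases σ <;>
  · simp only [poly, mem_setOf_eq, rowsP, Finset.forall_mem_insert, ev_sub, sub_pos,
      Bool.false_eq_true, if_false, if_true]
    tauto

/-- A nonzero affine datum gives a nonzero affine polynomial (injective variable map).
[folklore] -/
theorem affPoly_ne_zero {B N : ℕ} {ι : Fin B → Fin N} (hι : Function.Injective ι)
    {c : (Fin B → ℚ) × ℚ} (hc : c ≠ 0) : affPoly ι c ≠ 0 := by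
  intro h0
  have hev : ∀ x : Fin N → ℝ, ev c (fun i => x (ι i)) = 0 := fun x => by
    rw [← aeval_affPoly, h0, map_zero]
  have h2 : c.2 = 0 := by
    have := hev 0
    simp only [ev, Pi.zero_apply, mul_zero, Finset.sum_const_zero, zero_add] at this
    exact_mod_cast this
  have h1 : c.1 = 0 := by
    funext i
    have := hev (fun l => if l = ι i then 1 else 0)
    simp only [ev, hι.eq_iff, mul_ite, mul_one, mul_zero, Finset.sum_ite_eq', Finset.mem_univ,
      if_true, h2, Rat.cast_zero, add_zero] at this
    exact_mod_cast this
  exact hc (Prod.ext h1 h2)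

/-- The zero set of a nonzero rational polynomial is Lebesgue-null. [folklore] -/
theorem volume_aeval_null {N : ℕ} (q : MvPolynomial (Fin N) ℚ) (hq : q ≠ 0) :
    volume {x : Fin N → ℝ | MvPolynomial.aeval x q = 0} = 0 :=
  volume_setOf_aeval_eq_zero q fun h =>
    hq (MvPolynomial.map_injective _ (algebraMap ℚ ℝ).injective (h.trans (map_zero _).symm))

/-- **Bounded bands have lower and upper bounds**: if a bounded set is, fibrewise in the last
coordinate, cut out by `y > P` (`P ∈ LWs`) and `y < S` (`S ∈ UPs`) over its base, and is
non-empty, then `LWs` and `UPs` are non-empty. [folklore] -/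
theorem nonempty_bounds {N : ℕ} {D : Set (Fin (N + 1) → ℝ)} (hD : Bornology.IsBounded D)
    {ι : Type*} (LWs UPs : Finset ι) (PL PU : ι → (Fin N → ℝ) → ℝ) (cell : Set (Fin N → ℝ))
    (hmem : ∀ w, w ∈ D ↔ ((Fin.init w : Fin N → ℝ) ∈ cell ∧
      (∀ P ∈ LWs, PL P (Fin.init w) < w (Fin.last N)) ∧
      ∀ S ∈ UPs, w (Fin.last N) < PU S (Fin.init w)))
    {w : Fin (N + 1) → ℝ} (hw : w ∈ D) : LWs.Nonempty ∧ UPs.Nonempty := by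
  obtain ⟨C, hC⟩ := isBounded_iff_forall_norm_le.mp hD
  obtain ⟨hcell, hlw, hup⟩ := (hmem w).mp hw
  have key : ∀ c : ℝ, Function.update w (Fin.last N) c ∈ D → |c| ≤ C := by
    intro c hc
    have h := (norm_le_pi_norm (Function.update w (Fin.last N) c) (Fin.last N)).trans (hC _ hc)
    simpa using h
  by_contra hne
  rw [not_and_or, Finset.not_nonempty_iff_eq_empty, Finset.not_nonempty_iff_eq_empty] at hne
  set c₀ := C + |w (Fin.last N)| + 1 with hc₀
  have hC0 : 0 ≤ C := (norm_nonneg _).trans (hC w hw)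
  have habs : 0 ≤ |w (Fin.last N)| := abs_nonneg _
  rcases hne with hne | hne
  · have hmemc : Function.update w (Fin.last N) (w (Fin.last N) - c₀) ∈ D := by
      refine (hmem _).mpr ⟨by simpa [Fin.init_update_last] using hcell, by simp [hne], ?_⟩
      intro S hS
      simp only [Function.update_self, Fin.init_update_last]
      linarith [hup S hS]
    have h1 := key _ hmemc
    have h2 := abs_sub_abs_le_abs_sub c₀ (w (Fin.last N))
    rw [abs_sub_comm] at h2
    have hc₀abs : |c₀| = c₀ := abs_of_nonneg (by linarith)
    linarith
  · have hmemc : Function.update w (Fin.last N) (w (Fin.last N) + c₀) ∈ D := by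
      refine (hmem _).mpr ⟨by simpa [Fin.init_update_last] using hcell, ?_, by simp [hne]⟩
      intro P hP
      simp only [Function.update_self, Fin.init_update_last]
      linarith [hlw P hP]
    have h1 := key _ hmemc
    have h2 := abs_sub_abs_le_abs_sub c₀ (-w (Fin.last N))
    rw [abs_neg, show c₀ - -w (Fin.last N) = w (Fin.last N) + c₀ by ring] at h2
    have hc₀abs : |c₀| = c₀ := abs_of_nonneg (by linarith)
    linarith

/-! ### Integrating out a coordinate carrying a pole of order `≥ 2` -/

/-- **Integrating out the last coordinate when it carries a pole of order `n' + 2`.** Let `r₀`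
be a bounded representation on `{(x, y) | x ∈ poly ZRs, P(x) < y (P ∈ LWs), y < S(x) (S ∈ UPs)}`
with integrand `ratJ(x) · (y − ℓ(x))^{-(n'+2)}`. Then `[r₀]` is congruent modulo
`KZ.relations` to a `ℤ`-combination of elements of `JJ B 0`: dissect by "which lower bound is
the largest (`P`), which upper bound the smallest (`S`), on which side of `[P, S]` the pole lies"
(rule 1a; ties are null hyperplanes, the region `P ≤ ℓ ≤ S` is null by Tonelli since there the
fibre integral `∫_P^S |y − ℓ|^{-(n'+2)} dy` diverges unless the factor `ratJ` vanishes — a null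
algebraic set once degenerate data are discarded); on each piece apply Newton–Leibniz along `y`
with the rational primitive (`piece_step`).
[Kontsevich–Zagier 2001, §1.2, rules (1)–(3)] [folklore] -/
theorem flat_pole {B m : ℕ} (r₀ : KZ.IntegralRep (B + 1)) (ZRs LWs UPs : Finset ((Fin B → ℚ) × ℚ))
    (L : Fin m → (Fin B → ℚ) × ℚ) (e : Fin m → ℕ) (p : MvPolynomial (Fin B) ℚ)
    (ℓ : (Fin B → ℚ) × ℚ) (n' : ℕ)
    (hmem : ∀ w, w ∈ r₀.domain ↔ ((Fin.init w : Fin B → ℝ) ∈ poly B ZRs ∧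
      (∀ P ∈ LWs, ev P (Fin.init w) < w (Fin.last B)) ∧
      ∀ S ∈ UPs, w (Fin.last B) < ev S (Fin.init w)))
    (hr₀i : EqOn r₀.integrand (intG B m L e p ℓ (n' + 2)) r₀.domain)
    (hr₀b : Bornology.IsBounded r₀.domain) :
    ∃ c ∈ AddSubgroup.closure (JJ0 B), KZ.of r₀ - c ∈ KZ.relations := by
  classical
  by_cases hdeg : p = 0 ∨ ∃ j, e j ≠ 0 ∧ L j = 0
  · refine ⟨0, zero_mem _, ?_⟩
    rw [sub_zero]
    refine KZ.of_mem_relations_of_eqOn_zero r₀ fun w hw => ?_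
    rw [hr₀i hw]
    rcases hdeg with rfl | ⟨j, hj, hLj⟩
    · simp [intG, ratJ]
    · have : (∏ j, ev (L j) (Fin.init w) ^ e j) = 0 :=
        Finset.prod_eq_zero (Finset.mem_univ j) (by simp [hLj, hj, ev])
      simp [intG, ratJ, this]
  push Not at hdeg
  obtain ⟨hp, hL⟩ := hdeg
  set pc : ((Fin B → ℚ) × ℚ) × ((Fin B → ℚ) × ℚ) × Bool → Set (Fin (B + 1) → ℝ) :=
    fun idx => {w | (Fin.init w : Fin B → ℝ) ∈ poly B (rowsP ZRs LWs UPs idx.1 idx.2.1 ℓ idx.2.2) ∧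
      ev idx.1 (Fin.init w) < w (Fin.last B) ∧ w (Fin.last B) < ev idx.2.1 (Fin.init w)}
    with hpc
  have hpcsa : ∀ idx, IsSemialgebraic ℚ (pc idx) := fun idx =>
    isSemialgebraic_openBand (isSemialgebraic_poly B _) idx.1 idx.2.1
  have hpcsub : ∀ idx, pc idx ⊆ r₀.domain := by
    rintro ⟨P, S, σ⟩ w ⟨hw, hPw, hwS⟩
    rw [mem_poly_rowsP, mem_poly_rowsP₀] at hw
    obtain ⟨⟨hcell, hLP, hUS, -⟩, -⟩ := hw
    refine (hmem w).mpr ⟨hcell, fun P' hP' => ?_, fun S' hS' => ?_⟩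
    · by_cases hne : P' = P
      · rw [hne]; exact hPw
      · exact (hLP P' hne hP').trans hPw
    · by_cases hne : S' = S
      · rw [hne]; exact hwS
      · exact hwS.trans (hUS S' hne hS')
  set R : ((Fin B → ℚ) × ℚ) × ((Fin B → ℚ) × ℚ) × Bool → KZ.IntegralRep (B + 1) :=
    fun idx => r₀.restrict (pc idx) (hpcsa idx) (hpcsub idx) with hR
  set T : Finset (((Fin B → ℚ) × ℚ) × ((Fin B → ℚ) × ℚ) × Bool) :=
    LWs ×ˢ (UPs ×ˢ Finset.univ) with hT
  have hstep : ∀ idx, ∃ r' : KZ.IntegralRep B,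
      KZ.of (R idx) - KZ.of r' ∈ KZ.relations ∧ KZ.of r' ∈ JJ0 B := by
    rintro ⟨P, S, σ⟩
    refine piece_step (rowsP ZRs LWs UPs P S ℓ σ) L e p P S ℓ n'
      (fun x hx => ((mem_poly_rowsP₀ _ _ _ P S x).mp
        ((mem_poly_rowsP _ _ _ P S ℓ σ x).mp hx).1).2.2.2)
      (fun x hx => ?_) (R (P, S, σ)) (hr₀b.subset (hpcsub _)) rfl (hr₀i.mono (hpcsub _))
    have h := ((mem_poly_rowsP _ _ _ P S ℓ σ x).mp hx).2
    cases σ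
    · exact Or.inr (by simpa using h)
    · exact Or.inl (by simpa using h)
  choose rr hrr using hstep
  have hxw : ∀ w : Fin (B + 1) → ℝ, (fun i => w (Fin.castSucc i)) = Fin.init w := fun w => rfl
  set Ties : Set (Fin (B + 1) → ℝ) :=
    (⋃ P ∈ LWs, ⋃ P' ∈ LWs.erase P,
      {w | MvPolynomial.aeval w (affPoly Fin.castSucc (P - P')) = 0}) ∪
    (⋃ S ∈ UPs, ⋃ S' ∈ UPs.erase S,
      {w | MvPolynomial.aeval w (affPoly Fin.castSucc (S - S')) = 0}) with hTies_def
  have hTies : volume Ties = 0 := by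
    refine measure_union_null ?_ ?_ <;>
      refine (measure_biUnion_null_iff (Finset.countable_toSet _)).mpr fun P _ =>
        (measure_biUnion_null_iff (Finset.countable_toSet _)).mpr fun P' hP' =>
          volume_aeval_null _ (affPoly_ne_zero (Fin.castSucc_injective B)
            (sub_ne_zero.mpr ?_)) <;>
      exact fun h => (Finset.mem_erase.mp hP').1 h.symm
  set Zg : Set (Fin (B + 1) → ℝ) := {w | ratJ B m L e p (Fin.init w) = 0} with hZg_def
  have hZg : volume Zg = 0 := by
    have hsub : Zg ⊆ {w | MvPolynomial.aeval w (MvPolynomial.rename Fin.castSucc p) = 0} ∪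
        ⋃ j, {w | e j ≠ 0 ∧ MvPolynomial.aeval w (affPoly Fin.castSucc (L j)) = 0} := by
      intro w hw
      simp only [hZg_def, mem_setOf_eq, ratJ, div_eq_zero_iff, Finset.prod_eq_zero_iff,
        Finset.mem_univ, true_and, pow_eq_zero_iff', ne_eq] at hw
      simp only [mem_union, mem_setOf_eq, mem_iUnion, MvPolynomial.aeval_rename, aeval_affPoly,
        Function.comp_def]
      rcases hw with hw | ⟨j, hw, hj⟩
      · exact Or.inl hw
      · exact Or.inr ⟨j, hj, hw⟩
    refine measure_mono_null hsub (measure_union_null ?_ ?_)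
    · exact volume_aeval_null _ fun h =>
        hp (MvPolynomial.rename_injective _ (Fin.castSucc_injective B)
          (h.trans (map_zero _).symm))
    · refine measure_iUnion_null_iff.mpr fun j => ?_
      by_cases hj : e j = 0
      · simp [hj]
      · exact measure_mono_null (fun w hw => hw.2)
          (volume_aeval_null _ (affPoly_ne_zero (Fin.castSucc_injective B) (hL j hj)))
  set A : Set (Fin (B + 1) → ℝ) := {w | w ∈ r₀.domain ∧
    ((∀ P ∈ LWs, ev P (Fin.init w) ≤ ev ℓ (Fin.init w)) ∧
     (∀ S ∈ UPs, ev ℓ (Fin.init w) ≤ ev S (Fin.init w))) ∧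
    ratJ B m L e p (Fin.init w) ≠ 0} with hA_def
  have hAsa : IsSemialgebraic ℚ A := by
    have h1 : IsSemialgebraic ℚ ((⋂ P ∈ LWs, {w : Fin (B + 1) → ℝ |
        MvPolynomial.aeval w (affPoly Fin.castSucc P) ≤
          MvPolynomial.aeval w (affPoly Fin.castSucc ℓ)}) ∩
        ⋂ S ∈ UPs, {w : Fin (B + 1) → ℝ |
          MvPolynomial.aeval w (affPoly Fin.castSucc ℓ) ≤
            MvPolynomial.aeval w (affPoly Fin.castSucc S)}) :=
      (IsSemialgebraic.biInter _ _ fun P _ => isSemialgebraic_setOf_eval_le _ _).inter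
        (IsSemialgebraic.biInter _ _ fun S _ => isSemialgebraic_setOf_eval_le _ _)
    have hU : IsSemialgebraic ℚ (univ : Set (Fin (B + 1) → ℝ)) := isSemialgebraic_univ
    have hJu : IsSemialgebraicFunOn ℚ (univ : Set (Fin (B + 1) → ℝ))
        (fun w => ratJ B m L e p (Fin.init w)) :=
      (isSemialgebraicFunOn_ratJ L e p
        (isSemialgebraic_univ : IsSemialgebraic ℚ (univ : Set (Fin B → ℝ)))).comp_init.mono
        (fun _ _ => mem_univ _) hU
    have h2 : IsSemialgebraic ℚ {w : Fin (B + 1) → ℝ | w ∈ univ ∧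
        ratJ B m L e p (Fin.init w) = (fun _ => ((0 : ℚ) : ℝ)) w} :=
      isSemialgebraic_sep_eq hJu (isSemialgebraicFunOn_ratCast hU 0)
    convert r₀.isSemialgebraic_domain.inter (h1.inter h2.compl) using 1
    ext w
    simp only [hA_def, mem_setOf_eq, mem_inter_iff, mem_iInter, mem_compl_iff, mem_univ,
      true_and, aeval_affPoly, hxw, Rat.cast_zero]
  have hA : volume A = 0 := by
    refine volume_eq_zero_of_lintegral_fibre_eq_top (IsSemialgebraic.measurableSet_holds hAsa)
      (r₀.integrableOn.mono_set fun w hw => hw.1) fun x => ?_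
    by_cases hne : {t : ℝ | (Fin.snoc x t : Fin (B + 1) → ℝ) ∈ A} = ∅
    · exact Or.inl hne
    refine Or.inr ?_
    obtain ⟨t₀, ht₀⟩ := nonempty_iff_ne_empty.mpr hne
    have ht₀A : (Fin.snoc x t₀ : Fin (B + 1) → ℝ) ∈ A := ht₀
    obtain ⟨hdom₀, ⟨hmidP, hmidS⟩, hK⟩ := ht₀
    simp only [Fin.init_snoc] at hmidP hmidS hK
    obtain ⟨hLWne, hUPne⟩ := nonempty_bounds hr₀b LWs UPs ev ev (poly B ZRs) hmem hdom₀
    obtain ⟨P₀, hP₀, hP₀max⟩ := Finset.exists_max_image LWs (fun P => ev P x) hLWne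
    obtain ⟨S₀, hS₀, hS₀min⟩ := Finset.exists_min_image UPs (fun S => ev S x) hUPne
    have hcell : x ∈ poly B ZRs := by simpa using ((hmem _).mp hdom₀).1
    have hfib : {t : ℝ | (Fin.snoc x t : Fin (B + 1) → ℝ) ∈ A} = Ioo (ev P₀ x) (ev S₀ x) := by
      ext t
      simp only [hA_def, mem_setOf_eq, hmem, Fin.init_snoc, Fin.snoc_last, mem_Ioo]
      constructor
      · rintro ⟨⟨-, h1, h2⟩, -, -⟩
        exact ⟨h1 P₀ hP₀, h2 S₀ hS₀⟩
      · rintro ⟨h1, h2⟩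
        exact ⟨⟨hcell, fun P hP => (hP₀max P hP).trans_lt h1, fun S hS =>
          h2.trans_le (hS₀min S hS)⟩, ⟨hmidP, hmidS⟩, hK⟩
    have ht₀' : t₀ ∈ Ioo (ev P₀ x) (ev S₀ x) := by rw [← hfib]; exact ht₀A
    rw [hfib, setLIntegral_congr_fun measurableSet_Ioo (g := fun t =>
      ‖ratJ B m L e p x / (t - ev ℓ x) ^ (n' + 2)‖ₑ) fun t ht => ?_]
    · exact lintegral_enorm_div_pow_eq_top hK (ht₀'.1.trans ht₀'.2)
        ⟨hmidP P₀ hP₀, hmidS S₀ hS₀⟩ (by omega)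
    · have hmem' : (Fin.snoc x t : Fin (B + 1) → ℝ) ∈ A := by
        have : t ∈ {t : ℝ | (Fin.snoc x t : Fin (B + 1) → ℝ) ∈ A} := by rw [hfib]; exact ht
        exact this
      rw [hr₀i hmem'.1]
      simp only [intG, Fin.init_snoc, Fin.snoc_last, mul_one_div]
  have hcov : r₀.domain \ (⋃ idx ∈ T, (R idx).domain) ⊆ Ties ∪ (A ∪ Zg) := by
    rintro w ⟨hw, hwU⟩
    by_cases hK : ratJ B m L e p (Fin.init w) = 0
    · exact Or.inr (Or.inr hK)
    obtain ⟨hLWne, hUPne⟩ := nonempty_bounds hr₀b LWs UPs ev ev (poly B ZRs) hmem hw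
    obtain ⟨hcell, hlw, hup⟩ := (hmem w).mp hw
    set xb : Fin B → ℝ := Fin.init w with hxb
    obtain ⟨P₀, hP₀, hP₀max⟩ := Finset.exists_max_image LWs (fun P => ev P xb) hLWne
    obtain ⟨S₀, hS₀, hS₀min⟩ := Finset.exists_min_image UPs (fun S => ev S xb) hUPne
    by_cases htP : ∃ P' ∈ LWs.erase P₀, ev P' xb = ev P₀ xb
    · obtain ⟨P', hP', hP'e⟩ := htP
      refine Or.inl (Or.inl ?_)
      simp only [mem_iUnion]
      refine ⟨P₀, hP₀, P', hP', ?_⟩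
      simp only [mem_setOf_eq, aeval_affPoly, ev_sub, hxw, ← hxb, hP'e, sub_self]
    by_cases htS : ∃ S' ∈ UPs.erase S₀, ev S' xb = ev S₀ xb
    · obtain ⟨S', hS', hS'e⟩ := htS
      refine Or.inl (Or.inr ?_)
      simp only [mem_iUnion]
      refine ⟨S₀, hS₀, S', hS', ?_⟩
      simp only [mem_setOf_eq, aeval_affPoly, ev_sub, hxw, ← hxb, hS'e, sub_self]
    push Not at htP htS
    have hLP : ∀ P', P' ≠ P₀ → P' ∈ LWs → ev P' xb < ev P₀ xb := fun P' hne hP' =>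
      lt_of_le_of_ne (hP₀max P' hP') (htP P' (Finset.mem_erase.mpr ⟨hne, hP'⟩))
    have hUS : ∀ S', S' ≠ S₀ → S' ∈ UPs → ev S₀ xb < ev S' xb := fun S' hne hS' =>
      lt_of_le_of_ne (hS₀min S' hS') (htS S' (Finset.mem_erase.mpr ⟨hne, hS'⟩)).symm
    have hPy := hlw P₀ hP₀
    have hyS := hup S₀ hS₀
    have hmemT : ∀ σ, (P₀, S₀, σ) ∈ T := fun σ => by simp [hT, hP₀, hS₀]
    have hpiece : ∀ σ, (if σ then ev ℓ xb < ev P₀ xb else ev S₀ xb < ev ℓ xb) →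
        w ∈ pc (P₀, S₀, σ) := fun σ hσ =>
      ⟨(mem_poly_rowsP _ _ _ P₀ S₀ ℓ σ _).mpr ⟨(mem_poly_rowsP₀ _ _ _ P₀ S₀ _).mpr
        ⟨hcell, hLP, hUS, hPy.trans hyS⟩, hσ⟩, hPy, hyS⟩
    by_cases h1 : ev ℓ xb < ev P₀ xb
    · exact absurd (mem_iUnion₂.mpr ⟨(P₀, S₀, true), hmemT true, hpiece true (by simpa using h1)⟩)
        hwU
    by_cases h2 : ev S₀ xb < ev ℓ xb
    · exact absurd (mem_iUnion₂.mpr ⟨(P₀, S₀, false), hmemT false,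
        hpiece false (by simpa using h2)⟩) hwU
    push Not at h1 h2
    exact Or.inr (Or.inl ⟨hw, ⟨fun P hP => (hP₀max P hP).trans h1,
      fun S hS => h2.trans (hS₀min S hS)⟩, hK⟩)
  have hdis : KZ.of r₀ - ∑ idx ∈ T, KZ.of (R idx) ∈ KZ.relations := by
    refine KZ.of_sub_sum_of_mem_relations T r₀ R (fun idx _ => ?_) (fun idx _ w _ => rfl)
      (measure_mono_null hcov (measure_union_null hTies (measure_union_null hA hZg))) ?_
    · rw [show (R idx).domain \ r₀.domain = ∅ from Set.sdiff_eq_empty.mpr (hpcsub idx),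
        measure_empty]
    · intro idx hidx idx' hidx' hne
      rw [show (R idx).domain ∩ (R idx').domain = ∅ from ?_, measure_empty]
      obtain ⟨P, S, σ⟩ := idx
      obtain ⟨P', S', σ'⟩ := idx'
      simp only [hT, Finset.mem_coe, Finset.mem_product, Finset.mem_univ, and_true] at hidx hidx'
      refine Set.eq_empty_of_forall_notMem fun w hw2 => ?_
      obtain ⟨⟨hw, h1, h2⟩, ⟨hw', h1', h2'⟩⟩ := hw2
      rw [mem_poly_rowsP, mem_poly_rowsP₀] at hw hw'
      obtain ⟨⟨-, hLP, hUS, hPS⟩, hσ⟩ := hw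
      obtain ⟨⟨-, hLP', hUS', hPS'⟩, hσ'⟩ := hw'
      by_cases hP : P = P'
      · subst hP
        by_cases hS : S = S'
        · subst hS
          have hσσ : σ ≠ σ' := fun h => hne (by rw [h])
          cases σ <;> cases σ' <;> simp at hσσ hσ hσ' <;> linarith
        · exact lt_asymm (hUS S' (Ne.symm hS) hidx'.2) (hUS' S hS hidx.2)
      · exact lt_asymm (hLP P' (Ne.symm hP) hidx'.1) (hLP' P hP hidx.1)
  refine ⟨∑ idx ∈ T, KZ.of (rr idx),
    AddSubgroup.sum_mem _ fun idx _ => AddSubgroup.subset_closure (hrr idx).2, ?_⟩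
  have : KZ.of r₀ - ∑ idx ∈ T, KZ.of (rr idx) = (KZ.of r₀ - ∑ idx ∈ T, KZ.of (R idx)) +
      (∑ idx ∈ T, KZ.of (R idx) - ∑ idx ∈ T, KZ.of (rr idx)) := by abel
  rw [this]
  exact KZ.relations.add_mem hdis (KZ.sum_sub_sum_mem_relations T _ _ fun idx _ => (hrr idx).1)

end IntegrateOut

open IntegrateOut in
/-- **Integrating out a coordinate carrying a pole of order `≥ 2` over a rational polytope**
(registered sub-goal of `stub_integrateOut`, part 3): `IntegrateOut.flat_pole` restated. -/
theorem integrateOut_flatPole (B m n' : ℕ) (r₀ : KZ.IntegralRep (B + 1)) (ZRs LWs UPs : Finset ((Fin B → ℚ) × ℚ)) (L : Fin m → (Fin B → ℚ) × ℚ) (e : Fin m → ℕ) (p : MvPolynomial (Fin B) ℚ) (ℓ : (Fin B → ℚ) × ℚ) (hmem : ∀ w, w ∈ r₀.domain ↔ ((Fin.init w : Fin B → ℝ) ∈ IntegrateOut.poly B ZRs ∧ (∀ P ∈ LWs, IntegrateOut.ev P (Fin.init w) < w (Fin.last B)) ∧ ∀ S ∈ UPs, w (Fin.last B) < IntegrateOut.ev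 S (Fin.init w))) (hr₀i : Set.EqOn r₀.integrand (IntegrateOut.intG B m L e p ℓ (n' + 2)) r₀.domain) (hr₀b : Bornology.IsBounded r₀.domain) : ∃ c ∈ AddSubgroup.closure (IntegrateOut.JJ0 B), KZ.of r₀ - c ∈ KZ.relations :=
  flat_pole r₀ ZRs LWs UPs L e p ℓ n' hmem hr₀i hr₀b

end Summit.KontsevichZagierPeriods.ArrangementNormalForm.JanusBands
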